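import Literature.Probability.RandomPlanarGeometry.CurveSpace
import Mathlib.MeasureTheory.Measure.Portmanteau
import Mathlib.Topology.MetricSpace.Thickening
import HarnessLib

/-!
# Eventual smallness along a shrinking closed family with null limit event: stub
`stub_kernel_eventually_small_of_null_limit` (K9b) of line `hitting-tournament` for crux
`LagHandOff` (stmt-CriticalPhenomena-10268)

Abstract portmanteau step of the soft half of the boundary kernel (KERNEL-c5 §2).  Random curve
classes `Y n : Ω → CurveClass ℂ` converge in law to a probability measure `ν` (tested against
bounded continuous functions); `A : ℝ → Set (CurveClass ℂ)` is a family of CLOSED events,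
monotone in the parameter `ε > 0`, whose intersection `⋂_{ε > 0} A ε` is contained in an event
`A₀` with `ν A₀ = 0`.  Conclusion: for every `θ > 0` there is `ε > 0` with
`P (Y n ∈ A ε) < θ` for all large `n`.

Proof.
1. Continuity from above (`MeasureTheory.tendsto_measure_iInter_atTop`) along the antitone
   sequence `m ↦ A (1/(m+1))` of closed (hence Borel) sets of the finite measure `ν`:
   `ν (A (1/(m+1))) → ν (⋂ m, A (1/(m+1)))`, and `⋂ m, A (1/(m+1)) ⊆ ⋂_{ε > 0} A ε ⊆ A₀`
   (for `ε > 0` pick `m` with `1/(m+1) < ε`), so the limit is `0`; hence some `m` has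
   `ν (A (1/(m+1))) < θ` (`KernelNullLimit.exists_measure_lt_of_iInter_null`).
2. Closed-set portmanteau (`MeasureTheory.ProbabilityMeasure.limsup_measure_closed_le_of_tendsto`)
   for the laws `P ∘ (Y n)⁻¹ → ν`, packaged for random variables in
   `KernelNullLimit.limsup_measure_preimage_closed_le`:
   `limsup_n P (Y n ∈ A ε) ≤ ν (A ε) < θ` with `ε = 1/(m+1)`, and
   `Filter.eventually_lt_of_limsup_lt` concludes.

Helpers live in the sub-namespace `KernelNullLimit` and are stated for a general topological
space with `HasOuterApproxClosed` / `OpensMeasurableSpace` (any pseudo-metric Borel space).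
-/

noncomputable section

open Set Metric MeasureTheory Filter Topology
open scoped unitInterval BoundedContinuousFunction ENNReal
open Literature.Probability.RandomPlanarGeometry

namespace Summit.CriticalPhenomena.CardyFormulaZ2.Cruxes.LagHandOff.HittingTournament

namespace KernelNullLimit

variable {Ω X : Type*} [MeasurableSpace Ω] [MeasurableSpace X] [TopologicalSpace X]
  [OpensMeasurableSpace X]

/-- **Closed-set portmanteau for random variables.** If the laws of `Y n` under the probability
measure `P` converge to the probability measure `ν` in the sense that
`∫ f (Y n) dP → ∫ f dν` for every bounded continuous `f`, then for every closed set `F`,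
`limsup_n P (Y n ∈ F) ≤ ν F`.  (Mathlib's
`ProbabilityMeasure.limsup_measure_closed_le_of_tendsto` transported along
`ProbabilityMeasure.tendsto_iff_forall_integral_tendsto`, `integral_map` and `Measure.map_apply`.) -/
theorem limsup_measure_preimage_closed_le [HasOuterApproxClosed X] {P : Measure Ω}
    [IsProbabilityMeasure P] {Y : ℕ → Ω → X} (hY : ∀ n, Measurable (Y n)) {ν : Measure X}
    [IsProbabilityMeasure ν]
    (hconv : ∀ f : X →ᵇ ℝ, Tendsto (fun n => ∫ ω, f (Y n ω) ∂P) atTop (𝓝 (∫ x, f x ∂ν)))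
    {F : Set X} (hF : IsClosed F) :
    atTop.limsup (fun n => P (Y n ⁻¹' F)) ≤ ν F := by
  set μs : ℕ → ProbabilityMeasure X := fun n =>
    ⟨P.map (Y n), Measure.isProbabilityMeasure_map (hY n).aemeasurable⟩ with hμs
  set μ' : ProbabilityMeasure X := ⟨ν, inferInstance⟩ with hμ'
  have htend : Tendsto μs atTop (𝓝 μ') := by
    rw [ProbabilityMeasure.tendsto_iff_forall_integral_tendsto]
    intro f
    have e1 : ∀ n, ∫ y, f y ∂(μs n : Measure X) = ∫ ω, f (Y n ω) ∂P := fun n => by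
      show ∫ y, f y ∂(P.map (Y n)) = ∫ ω, f (Y n ω) ∂P
      exact integral_map (hY n).aemeasurable f.continuous.aestronglyMeasurable
    have e1' : ∫ y, f y ∂(μ' : Measure X) = ∫ x, f x ∂ν := rfl
    rw [e1']
    exact (hconv f).congr fun n => (e1 n).symm
  have hlim := ProbabilityMeasure.limsup_measure_closed_le_of_tendsto htend hF
  have e2 : ∀ n, ((μs n : ProbabilityMeasure X) : Measure X) F = P (Y n ⁻¹' F) := fun n => by
    show (P.map (Y n)) F = P (Y n ⁻¹' F)
    exact Measure.map_apply (hY n) hF.measurableSet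
  simp_rw [e2] at hlim
  exact hlim

/-- **Continuity from above along a shrinking closed family.** If `A ε` is closed for `ε > 0`,
monotone in `ε`, and `⋂_{ε > 0} A ε ⊆ A₀` with `ν A₀ = 0` for a finite measure `ν`, then for
every `θ > 0` some member `A (1/(m+1))` of the family has `ν`-measure `< θ`. -/
theorem exists_measure_lt_of_iInter_null (ν : Measure X) [IsFiniteMeasure ν] {A : ℝ → Set X}
    {A₀ : Set X} (hcl : ∀ ε : ℝ, 0 < ε → IsClosed (A ε))
    (hmono : ∀ ε ε' : ℝ, 0 < ε → ε ≤ ε' → A ε ⊆ A ε')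
    (hsub : (⋂ (ε : ℝ) (_ : 0 < ε), A ε) ⊆ A₀) (hnull : ν A₀ = 0) {θ : ℝ≥0∞} (hθ : 0 < θ) :
    ∃ m : ℕ, ν (A (1 / ((m : ℝ) + 1))) < θ := by
  set B : ℕ → Set X := fun m => A (1 / ((m : ℝ) + 1)) with hB
  have hpos : ∀ m : ℕ, (0 : ℝ) < 1 / ((m : ℝ) + 1) := fun m => Nat.one_div_pos_of_nat
  have hanti : Antitone B := fun m m' hmm' =>
    hmono _ _ (hpos m') (Nat.one_div_le_one_div hmm')
  have hmeas : ∀ m, NullMeasurableSet (B m) ν := fun m =>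
    (hcl _ (hpos m)).measurableSet.nullMeasurableSet
  have hinter : (⋂ m, B m) ⊆ ⋂ (ε : ℝ) (_ : 0 < ε), A ε := by
    intro x hx
    refine mem_iInter₂.2 fun ε hε => ?_
    obtain ⟨m, hm⟩ := exists_nat_one_div_lt hε
    exact hmono _ _ (hpos m) hm.le (mem_iInter.1 hx m)
  have hzero : ν (⋂ m, B m) = 0 := measure_mono_null (hinter.trans hsub) hnull
  have hlim : Tendsto (ν ∘ B) atTop (𝓝 0) := by
    rw [← hzero]
    exact tendsto_measure_iInter_atTop hmeas hanti ⟨0, measure_ne_top ν _⟩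
  obtain ⟨m, hm⟩ := (hlim.eventually (gt_mem_nhds hθ)).exists
  exact ⟨m, hm⟩

end KernelNullLimit

open KernelNullLimit in
/-- **K9b `stub_kernel_eventually_small_of_null_limit`.** Let `Y n : Ω → CurveClass ℂ` be
random curve classes whose laws under the probability measure `P` converge to the probability
measure `ν` (against bounded continuous test functions), and let `A ε` (`ε > 0`) be closed events,
monotone in `ε`, with `⋂_{ε > 0} A ε ⊆ A₀` and `ν A₀ = 0`.  Then for every `θ > 0` there is
`ε > 0` such that `P (Y n ∈ A ε) < θ` eventually in `n`.  Proof: continuity from above gives `m`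
with `ν (A (1/(m+1))) < θ` (`exists_measure_lt_of_iInter_null`); the closed-set portmanteau
inequality (`limsup_measure_preimage_closed_le`) gives
`limsup_n P (Y n ∈ A (1/(m+1))) ≤ ν (A (1/(m+1))) < θ`, whence eventual `< θ`. -/
theorem stub_kernel_eventually_small_of_null_limit :
    ∀ {Ω : Type*} [MeasurableSpace Ω] (P : Measure Ω) [IsProbabilityMeasure P]
      (Y : ℕ → Ω → CurveClass ℂ), (∀ n, Measurable (Y n)) →
      ∀ (ν : Measure (CurveClass ℂ)) [IsProbabilityMeasure ν],
      (∀ f : CurveClass ℂ →ᵇ ℝ, Tendsto (fun n => ∫ ω, f (Y n ω) ∂P) atTop (𝓝 (∫ γ, f γ ∂ν))) →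
      ∀ (A : ℝ → Set (CurveClass ℂ)) (A₀ : Set (CurveClass ℂ)),
      (∀ ε : ℝ, 0 < ε → IsClosed (A ε)) → (∀ ε ε' : ℝ, 0 < ε → ε ≤ ε' → A ε ⊆ A ε') →
      (⋂ (ε : ℝ) (_ : 0 < ε), A ε) ⊆ A₀ → ν A₀ = 0 →
      ∀ θ : ℝ≥0∞, 0 < θ → ∃ ε : ℝ, 0 < ε ∧ ∀ᶠ n in atTop, P (Y n ⁻¹' A ε) < θ := by
  intro Ω _ P _ Y hY ν _ hconv A A₀ hcl hmono hsub hnull θ hθ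
  obtain ⟨m, hm⟩ := exists_measure_lt_of_iInter_null ν hcl hmono hsub hnull hθ
  have hpos : (0 : ℝ) < 1 / ((m : ℝ) + 1) := Nat.one_div_pos_of_nat
  refine ⟨1 / ((m : ℝ) + 1), hpos, ?_⟩
  exact eventually_lt_of_limsup_lt
    ((limsup_measure_preimage_closed_le hY hconv (hcl _ hpos)).trans_lt hm)

end Summit.CriticalPhenomena.CardyFormulaZ2.Cruxes.LagHandOff.HittingTournament

end
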